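import Literature.Analysis.FluidPDE.ChenHou2021HolderBoundaryBlowup
import HarnessLib

/-!
# Chen–Hou 2022/2023: finite-time blow-up of the 2D Boussinesq equations on the half plane from
# SMOOTH compactly supported data (Part I Theorem 1 / Theorem 3, Part II Theorem 2 — computer-assisted),
# as a named fact in the half-plane Boussinesq vocabulary

J. Chen, T. Y. Hou, *Stable nearly self-similar blowup of the 2D Boussinesq and 3D Euler equations with
smooth data I: Analysis*, arXiv:2210.07191 [arXiv221007191] (`p.`/`L` = chunk/line of the held rendering),
§1 Theorem 1 (informal, p0003 L19) made precise by §2.2 Theorem 3 (p0008 L22); *II: Rigorous numerics*,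
arXiv:2305.05660 [ChenHou2023RigorousNumerics] (the computer-assisted verification of the stability
constants; published summary PNAS 122 (2025) [ChenHou2025]). The 3D Euler half of the same paper
(§1 Theorem 2 / §6.1 Theorem 4) is the tree's `ChenHou2022_axisymmetricEulerBlowup` (`ChenHouBlowup.lean`);
the printed constants `E_* = 5·10⁻⁶`, `200E_*`, `100E_*`, rank `< 50` are `ChenHouFrameworkConstants.lean`;
the stability lemmas are PROVED in `ChenHouStabilityLemma.lean`; the exponents `c̄_l, c̄_ω` are
`chenHou_cl`, `chenHou_cω` (`SelfSimilarCollapseAnsatz.lean`). This file adds the BOUSSINESQ statement,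
which had no decl, in the vocabulary of `ChenHou2021HolderBoundaryBlowup.lean`
(`IsClassicalBoussinesqOnHalfPlane`: velocity form on the open upper half plane with the no-flow wall,
force `−θ e₂`, Chen–Hou orientation `ω = −curl2 u` — see that file's module docstring).

HONEST FRAMING (cell ns-blowup, zones Z5/Z8; D-0081 A4 topic 1). A COMPUTER-ASSISTED theorem about 2D
BOUSSINESQ WITH A SOLID WALL. WHAT THIS IS NOT: not Navier–Stokes; not whole space; the approximate
profile `(θ̄, ω̄)` is numerical data shipped with Part II, so the stability half of the theorem is
recorded in the docstring, not typed (same policy as `ChenHouBlowup.lean`).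

## The printed statements

**Part I, Theorem 1** (p0003 L19–L22): "Let `θ`, `u` and `ω` be the density, velocity and vorticity in
the 2D Boussinesq equations (eq:bous1)–(eq:biot), respectively. There is a family of smooth initial data
`(θ₀, ω₀)` with `θ₀` being even and `ω₀` being odd, such that the solution of the Boussinesq equations
develops a singularity in finite time `T < +∞`. The initial velocity field `u₀` has finite energy. The
blowup solution `(θ(t), ω(t))` is nearly self-similar in the sense that `(θ(t), ω(t))` with suitable
dynamic rescaling is close to an approximate blowup profile `(θ̄, ω̄)` up to the blowup time. Moreover,
the blowup is stable for initial data `(θ₀, ω₀)` close to `(θ̄, ω̄)` in some weighted `L^∞` and `C^{1/2}`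
norm."

**Part I, Theorem 3** (§2.2, p0008 L22–L31): "Let `(θ̄, ω̄, ū, c̄_l, c̄_ω)` be the approximate
self-similar profile constructed in Section 3 and `E_* = 5·10⁻⁶`. Assume that even initial data `θ₀` and
odd `ω₀` of (eq:bousdy1) satisfy `E(ω₀ − ω̄, θ_{0,x} − θ̄_x, θ_{0,y} − θ̄_y) < E_*`. We have
`‖ω − ω̄‖_{L^∞}, ‖θ_x − θ̄_x‖_{L^∞}, ‖θ_y − θ̄_y‖_∞ < 200E_*`, `|u_x(t,0) − ū_x(0)|, |c̄_ω − c_ω| < 100E_*`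
for all time. In particular, we can choose smooth initial data `ω₀, θ₀ ∈ C_c^∞` in this class with finite
energy `‖u₀‖_{L²} < +∞` such that the solution to the physical equations (eq:bous1)–(eq:biot) with these
initial data blows up in finite time `T`." Equations (§1, p0007 L19–L25): `ω_t + u·∇ω = θ_x`,
`θ_t + u·∇θ = 0` "on the upper half space", "`−Δφ = ω`, `u = −φ_y`, `v = φ_x`, where `φ` is the stream
function with the no-flow boundary condition `φ(x,0) = 0` at `y = 0`"; symmetry `ω(x,y) = −ω(−x,y)`,
`θ(x,y) = θ(−x,y)` (§6.1, p0054 L25). Passage to blow-up (§6.5 p0066 L44, "follows the argument in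
[chen2019finite2]" = Chen–Hou 2021 §8.6.2: `T* = t(∞) < ∞` and "`‖ω_phy‖_{L^∞}` and `‖∇θ_phy‖_{L^∞}`
blowup at `T*`" — indeed `c̄_ω + c_ω < −1/2` (p0066) forces `C_ω(τ) → 0`, and
`ω_phy = C_ω⁻¹ ω`, `∇θ_phy = C_ω⁻² ∇θ` by the Boussinesq scaling `c_θ = c_l + 2c_ω`).

## The named fact (typed by its printed consequence; weaker than print)

`ChenHou2022_boussinesqSmoothBlowup`: there exist `T > 0` and a classical solution `(u, p, θ)` of the 2D
Boussinesq equations on the upper half plane with the no-flow wall on `[0, T)`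
(`IsClassicalBoussinesqOnHalfPlane`), smooth up to the wall at every `t < T`, whose initial data have
`θ(0)` even and `ω(0) = −curl2 u(0)` odd in `x` (equivalently `curl2 u(0)` odd), both compactly supported
in the closed half plane, with `u(0)` of finite energy on `ℝ²₊`, and such that `‖ω(t)‖_{L^∞(ℝ²₊)}` and
`‖∇θ(t)‖_{L^∞(ℝ²₊)}` are unbounded as `t ↑ T`. NOT asserted (printed, recorded above): nearly
self-similar behaviour, stability near `(θ̄, ω̄)`, the constants `E_*`, `200E_*`, `100E_*` (typed as data
elsewhere), uniqueness.
-/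

noncomputable section

open Set Filter Topology MeasureTheory
open scoped RealInnerProductSpace NNReal ContDiff

namespace Literature.Analysis.FluidPDE

/-- The reflection `x ↦ −x` of the horizontal variable on `ℝ²`: `(x, y) ↦ (−x, y)` (the symmetry of the
printed class: `θ` even, `ω` odd in `x`). [cite: arXiv221007191, §6.1 (arXiv:2210.07191 p0054 L25: ω(x,y) = −ω(−x,y), θ(x,y) = θ(−x,y))] -/
def reflectX (x : EuclideanSpace ℝ (Fin 2)) : EuclideanSpace ℝ (Fin 2) :=
  (WithLp.equiv 2 (Fin 2 → ℝ)).symm ![-(x 0), x 1]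

/-- Components of the reflection: `(reflectX x)₀ = −x₀`, `(reflectX x)₁ = x₁`.
[cite: arXiv221007191, §6.1 (arXiv:2210.07191 p0054 L25)] -/
@[simp] theorem reflectX_apply_zero (x : EuclideanSpace ℝ (Fin 2)) : reflectX x 0 = -(x 0) := rfl

/-- Second component of the reflection. [cite: arXiv221007191, §6.1 (arXiv:2210.07191 p0054 L25)] -/
@[simp] theorem reflectX_apply_one (x : EuclideanSpace ℝ (Fin 2)) : reflectX x 1 = x 1 := rfl

/-- The reflection preserves the half plane. [cite: arXiv221007191, §6.1 (arXiv:2210.07191 p0054 L25–L27)] -/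
theorem reflectX_mem_boussinesqHalfPlane_iff (x : EuclideanSpace ℝ (Fin 2)) :
    reflectX x ∈ boussinesqHalfPlane ↔ x ∈ boussinesqHalfPlane := by
  simp

/-- **Chen–Hou 2022/2023, Part I Theorem 1 / Theorem 3 (last sentence), Part II Theorem 2 — finite-time
blow-up of the 2D Boussinesq equations on the half plane from smooth compactly supported data with finite
energy (computer-assisted proof)**, typed by its printed consequence: there are `T > 0` and a classical
Boussinesq solution `(u, p, θ)` on `[0, T) × ℝ²₊` with the no-flow wall, smooth up to the wall for each
`t < T`, with `θ(0)` even and `curl2 u(0)` odd in `x`, `θ(0)` and `curl2 u(0)` compactly supported in the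
closed half plane, `u(0)` of finite energy on `ℝ²₊`, and with `‖curl2 u(t)‖_{L^∞(ℝ²₊)}` and
`‖∇θ(t)‖_{L^∞(ℝ²₊)}` unbounded as `t ↑ T`. [cite: arXiv221007191, §1 Theorem 1 (p0003 L19–L22); §2.2 Theorem 3 (p0008 L22–L31); §6.5 (p0066 L44)] [cite: ChenHou2023RigorousNumerics, §1 Theorem 2] -/
def ChenHou2022_boussinesqSmoothBlowup : Prop :=
  ∃ T : ℝ, 0 < T ∧
    ∃ (u : ℝ → EuclideanSpace ℝ (Fin 2) → EuclideanSpace ℝ (Fin 2))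
      (p θ : ℝ → EuclideanSpace ℝ (Fin 2) → ℝ),
      IsClassicalBoussinesqOnHalfPlane (Ico 0 T) u p θ ∧
      (∀ t ∈ Ico 0 T,
        ContDiffOn ℝ ∞ (u t) (closure (boussinesqHalfPlane : Set (EuclideanSpace ℝ (Fin 2)))) ∧
        ContDiffOn ℝ ∞ (θ t) (closure (boussinesqHalfPlane : Set (EuclideanSpace ℝ (Fin 2))))) ∧
      (∀ x ∈ closure (boussinesqHalfPlane : Set (EuclideanSpace ℝ (Fin 2))),
        θ 0 (reflectX x) = θ 0 x ∧ curl2 (u 0) (reflectX x) = -curl2 (u 0) x) ∧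
      HasCompactSupportOnHalfPlane (θ 0) ∧ HasCompactSupportOnHalfPlane (curl2 (u 0)) ∧
      HasFiniteEnergyOnHalfPlane (u 0) ∧
      PlanarVorticityBlowsUpOnHalfPlaneAt u T ∧ DensityGradientBlowsUpOnHalfPlaneAt θ T

/-- The smooth-data fact gives blow-up data in every Hölder class `C^{1,α}` restricted to any compact
subset — recorded only as the obvious projection: it yields a finite-time blow-up Boussinesq solution on
the half plane (dropping the regularity and symmetry clauses), the shape shared with
`ChenHou2021_boussinesqHolderBlowup`. [cite: arXiv221007191, §2.2 Theorem 3 (arXiv:2210.07191 p0008 L31)] -/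
theorem ChenHou2022_boussinesqSmoothBlowup.exists_blowup (h : ChenHou2022_boussinesqSmoothBlowup) :
    ∃ T : ℝ, 0 < T ∧
      ∃ (u : ℝ → EuclideanSpace ℝ (Fin 2) → EuclideanSpace ℝ (Fin 2))
        (p θ : ℝ → EuclideanSpace ℝ (Fin 2) → ℝ),
        IsClassicalBoussinesqOnHalfPlane (Ico 0 T) u p θ ∧ PlanarVorticityBlowsUpOnHalfPlaneAt u T := by
  obtain ⟨T, hT, u, p, θ, hsol, -, -, -, -, -, hω, -⟩ := h
  exact ⟨T, hT, u, p, θ, hsol, hω⟩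

end Literature.Analysis.FluidPDE

end
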